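import Literature.NumberTheory.EllipticCurves.Kato2004.AdmissibleZetaClass
import Literature.NumberTheory.EllipticCurves.Kato2004.Condition1252
import Literature.NumberTheory.EllipticCurves.Kato2004.IwasawaCohomologyExistsProofs
import Literature.NumberTheory.EllipticCurves.CyclotomicZpExtension
import HarnessLib

/-!
# Kato 2004 (Astérisque 295), Thm. 12.5 (1) + (4): for `p ≠ 2` under (12.5.2) the `p`-adic zeta elements
# are INTEGRAL — `Z(f, T) ⊂ 𝐇¹(T)` — i.e., in the tree's vocabulary, an ADMISSIBLE zeta class EXISTS in every
# pinned `𝐇¹_Γ(T_pW)` (REALISABILITY of `Kato2004.IsAdmissibleZetaClass`). ONE named fact + proved corollaries.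

Topic `NumberTheory/EllipticCurves`, sub-directory `Kato2004` (namespace = path). Typed by seat
`literature-prover-bsd-armP-typer-07-g0` (ARM-P typist, fact F051 «Kato2004 Thm 12.5 (1)+(4) realisability»;
requested by the bench seat of stub `stub_admissibleZetaClassExists` on crux stmt-BirchSwinnertonDyer-23259,
= route item stmt-BirchSwinnertonDyer-23029 `AdmissibleZetaClassExists` of `Theses/DerivedKatoValuationDoor`).
ONE named fact `def … : Prop` (D-0014: nothing is asserted, no `_holds` here) and four PROVED corollaries
(re-shapings for the consumer); no `instance`, no notation, no `sorry`. HONEST FRAMING: the Birch–Swinnerton-Dyer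
conjecture is not advanced by typing this fact; a Summits-side close through it is CONDITIONAL on it.

## The printed statements (K. Kato, Astérisque 295 (2004) 117–290; `[p. N]` = printed page; store key
## `paper:doi-10-24033-ast-639`, PDF page `N − 115`; re-read 2026-08-29)

* **§12.3 [p. 221]** "`Λ = O_λ[[G_∞]]`. Consider the two dimensional representation `V_{F_λ}(f)` of `Gal(ℚ̄/ℚ)`
  over `F_λ` associated to `f` (8.3). We will prove the following results Thm. 12.4, 12.5, 12.6."
* **Thm. 12.5 (1) [p. 221]** "There exists a unique `F_λ`-linear map `V_{F_λ}(f) → 𝐇¹(V_{F_λ}(f)); γ ↦ 𝐳_γ^{(p)}`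
  having the following property: Let `r ∈ ℤ`, `1 ≤ r ≤ k − 1`, let `n ≥ 0`, and let `γ ∈ V_{F_λ}(f)`. Then the
  image of `𝐳_γ^{(p)}` under the composite map `𝐇¹(V_{F_λ}(f)) → H¹(ℚ(ζ_{p^n}), V_{F_λ}(f)(k − r)) →exp*
  S(f) ⊗_F F_λ ⊗ ℚ(ζ_{p^n})` … belongs to `S(f) ⊗_F ℚ(ζ_{p^n})`, and the map `x ⊗ y ↦ Σ_{σ ∈ G_n} χ(σ)σ(y)·per_f(x)^±`
  … sends the image of `𝐳_γ^{(p)}` to `(2πi)^{k−r−1} · L_{(p)}(f, χ, r) · γ^±`" (`±` the sign of `χ(−1)(−1)^{k−r−1}`).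
* **Thm. 12.5 (2) [p. 221]** "Let `Z(f)` be the `Λ ⊗ ℚ`-submodule of `𝐇¹(V_{F_λ}(f))` generated by `𝐳_γ^{(p)}` for all
  `γ ∈ V_{F_λ}(f)`. Then `𝐇¹(V_{F_λ}(f))/Z(f)` is a torsion `Λ ⊗ ℚ`-module."
* **Thm. 12.5 (4) [p. 222]** "Let `T` be a `Gal(ℚ̄/ℚ)`-stable `O_λ`-lattice of `V_{F_λ}(f)`, and let `Z(f, T)` be the
  `Λ`-submodule of `𝐇¹(T) ⊗ ℚ` generated by `𝐳_γ^{(p)}` for all `γ ∈ T`. Assume `p ≠ 2`, and assume that the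
  following (12.5.2) is satisfied. **(12.5.2)** There exists an `O_λ`-basis of `T` for which the image of the
  homomorphism `Gal(ℚ̄/ℚ(ζ_{p^∞})) → GL_{O_λ}(T) ≃ GL₂(O_λ)` contains `SL₂(ℤ_p)`. Here the last isomorphism is
  given by this basis of `T`. Then, `Z(f, T) ⊂ 𝐇¹(T)`. Furthermore, `length_{Λ_𝔭}(𝐇²(T)_𝔭) ≤
  length_{Λ_𝔭}(𝐇¹(T)_𝔭/Z(f, T)_𝔭)` for any prime ideal `𝔭` of `Λ` of height one unless `f` and `𝔭` satisfy
  (12.5.1) in (3)."  Proof, **§13.14 [p. 234]**: "Since `T = a·V_{O_λ}(f)` for some `a ∈ F_λ^×` under the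
  assumption of Thm. 12.5 (4) (see 12.8), we may assume `T = V_{O_λ}(f)`. In this case, since `Z(f, T)/Z` is a
  finite group, `Z(f, T)_𝔭 ⊂ 𝐇¹(T)_𝔭` for any prime ideal `𝔭` of `Λ` of height one. Since `𝐇¹(T)` is a free
  `Λ`-module under the assumption of 12.5 (4) by 12.4 (2), this means `Z(f, T) ⊂ 𝐇¹(T)`."  (§13.9–13.12
  [pp. 229–232]: `𝐳_γ^{(p)}` is first defined in `𝐇¹(V) ⊗_Λ Q(Λ)` by dividing the INTEGRAL `(c, d)`-classes
  `_{c,d}𝐳^{(p)}_{p^∞}(f, k, j, α, prime(pN))` by the four-cusp multiplier `μ(c, d, j)` and the Euler-type factors,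
  and shown to lie in `𝐇¹(V)`; 12.8 [p. 223]: under (12.5.2) every stable lattice is `aT`, `a ∈ F_λ^×`.)
* **p. 119**: "Since it is now known that all elliptic curves over `ℚ` are modular ([Wi] [BCDT]), this gives also
  results … for elliptic curves over `ℚ`"; **17.5 [p. 274]**: "In the case `f` of weight `2` and `T = (T_pE)(−1)` for
  an elliptic curve `E` over `ℚ`".

## What is typed, and why it is the printed statement in the tree's vocabulary

Elliptic-curve specialisation (`k = 2`, `F = ℚ`, `O_λ = ℤ_p`, `T = T_pW(−1)`, `Δ`-trivial component along the
cyclotomic `ℤ_p`-extension — the READING of record of this directory, `IwasawaCohomology.lean`): Kato's hypothesis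
(12.5.2) for `T_pE` is VERBATIM the tree's `Kato2004.ImageContainsSL2 W p` (`Condition1252.lean`; the Tate twist is
invisible on `Gal(ℚ̄/ℚ(ζ_{p^∞}))`; equivalent to `∀ n, W.HasSurjectiveModNGaloisRep (p ^ n)`, and for `p ≥ 5` to
`W.HasSurjectiveModNGaloisRep p`, both tree theorems), Kato's `𝐇¹(T)` on the `Δ`-trivial component is rkm's pinned
interface `I : IwasawaH1Data W p κ γ` (ANY pin: the axioms `proj_injective`/`proj_surjective`/`proj_T_smul`/
`proj_C_smul` identify `I.H` with `lim←_n H¹(ℤ_n[1/p], T_pW)` and its `Λ`-structure — cf. `thm12_4`, stated over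
every `I` in the same way), and «`z₀ ∈ I.H` is, up to `Λˣ`, Kato's `Ω_W`-normalised zeta element `𝐳_{γ_W}`,
`γ_W ∈ T_pW` the image of a generator of `H₁(W(ℂ), ℤ)⁺`» is the CLOSED predicate
`Kato2004.IsAdmissibleZetaClass W p κ hκ I z₀` (`AdmissibleZetaClass.lean`, v2: witnesses (A0)–(A4), (A5′), (A6′)
of its module docstring).  That file's audit of record reads: «`{z₀ : IsAdmissibleZetaClass W p K hK I z₀} =
Λˣ·𝐳_{γ_W} ∩ I.H` — empty iff `𝐳_{γ_W} ∉ 𝐇¹_Γ` (the integrality clause `Z(f,T)_𝔭 ⊂ 𝐇¹(T)_𝔭` of Conj. 12.10 /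
Thm. 12.5 (4) under (12.5.2)) or `p = 2`» and «REALISABLE by PRINT for `p` odd whenever (i) `𝐳_{γ_W} ∈ 𝐇¹_Γ(T_pW)`
(Kato Thm. 12.5 (4) under (12.5.2) …) and (ii) admissible parameters exist … (iii) `σ_c, σ_{d₁}, σ_ℓ` exist».
THIS FILE makes that realisability sentence a NAMED FACT, with exactly Kato's printed hypotheses of Thm. 12.5 (4)
— `p ≠ 2` and (12.5.2) — and nothing else: `exists_isAdmissibleZetaClass_of_imageContainsSL2`.

How print yields it (the sources of each existential witness of `AdmissibleZetaClassBody`; numbers, not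
adjectives — six inputs): (A0) the newform `f` of `W` — the Modularity Theorem [BreuilConradDiamondTaylor2001,
Thm. A], invoked exactly as Kato does on p. 119 (tree: the named fact `exists_isNewformOf`); (12.5.2) forces `W[p]`
irreducible (`hasSurjectiveModNGaloisRep_of_imageContainsSL2`), which places Kato's lattice on `T_pW`.
(A1)–(A4) THE value-pinned `(c, d₁)`-family and its Λ-adic lift `y ∈ I.H` — Kato (8.1.3), Prop. 8.12, §9.4,
Thm. 9.7 ∘ Thm. 6.6 (1), Ex. 13.3 with the dual exponential of [BlochKato1990] §3 DEFINED (tree: the named fact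
`exists_eulerSystem_definedExpStar_values` and the theorem `IwasawaH1Data.exists_unique_lift`); the rationality of
the constant `q` for the Tate-duality-normalised generator `d` of (A2) is Thm. 12.5 (1) («belongs to
`S(f) ⊗_F ℚ(ζ_{p^n})`») with [BlochKato1990] Prop. 3.8 / Ex. 3.11.  (A3) admissible parameters: any `A ≥ 1` and `a`
with `[a/A]⁻_f ≠ 0` (a non-zero minus symbol exists since `Ω⁻_f ≠ 0`, [Manin1972] Cor. 3.6), `c = 1 + 6pA·t`,
`d₁ = 1 + 6pNA·s` (`t, s ≥ 1`), `d′ = 1`, whence `R⁻_𝟙 = c d₁ (c − 1)(d₁ − 1)·[a/A]⁻_f ≠ 0` (Lemma 13.10 (1) p. 230,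
Lemma 13.11 (2) p. 231).  (A5′) the lattice `ℤ·q⁻` of minus symbols ([Manin1972] Cor. 3.6;
[MazurTateTeitelbaum1986Invent] §I.8; tree `ratCast_ratMinusSymbol`) and Galois elements of prescribed cyclotomic
character `c, d₁, ℓ ∈ ℤ_pˣ` (the cyclotomic character of `ℚ` is onto, tree theorem
`GaloisRep.cyclotomicCharacter_surjective`).  (A6′) `Ω⁺_f/Ω_W ∈ ℚˣ`: `Λ_f = c₀⁻¹·Λ_{E₀}` for the optimal curve
`E₀` and its Manin constant `c₀ ∈ ℤ ∖ {0}` ([Edixhoven1991] §1; only `c₀ ∈ ℚˣ` is used, [Manin1972] Thm. 1.6 /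
Cor. 3.6), and `Ω_{E₀}/Ω_W ∈ ℚˣ` along a `ℚ`-isogeny `W ~ E₀` (Faltings; the pull-back of a Néron differential
is a rational multiple of a Néron differential, [folklore]); and the POSITION
`((p : Λ)^{(−e)⁺}·M̃) • z₀ = (u·(p : Λ)^{e⁺}) • y`, `u ∈ Λˣ`, for `z₀ := 𝐳_{γ_W}`: both sides are elements of the
rank-one `Λ ⊗ ℚ`-module `I.H ⊗ ℚ` (Thm. 12.4 (2)) with the SAME dual-exponential values at every finite-order
character — `M̃(χ)·L_{(p)}(W, χ̄, 1)/Ω_W` versus `q·R⁻_χ̄·∏_{ℓ∣A, ℓ≠p} P_ℓ(χ̄(ℓ)ℓ⁻¹)·L_{(p)}(W, χ̄, 1)/Ω⁺_f` up to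
`p^e = |Ω⁺_f/(Ω_W q q⁻)|_p⁻¹` and units of `Λ` (Thm. 12.5 (1); Ex. 13.3 p. 225 for `L_S/L_{(p)}`; Lemma 13.10 (1))
— hence equal by Kato's argument of p. 230 («Since `𝐇¹(V_{F_λ}(f))` is a free `Λ[1/p]`-module of rank 1
(Thm. 12.4 (2)) …»; generic non-vanishing [RohrlichInventiones1984]); and `z₀ = 𝐳_{γ_W} ∈ I.H` IS Thm. 12.5 (4)
(`γ_W ∈ T_pW` is integral).  Secondary sources restating the integrality under (12.5.2):
[Kim2024BeilinsonKatoZetaGuide] §2.5.1 (Thm. 2.18: `z_{ℚ_∞} ∈ H¹_Iw(ℚ, T)`) and §4.3 («We now suppose that the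
image of `ρ` contains the conjugate of `SL₂(ℤ_p)` … we obtain an integral Euler system»);
[Kim2022RefinedKatoApplications] §1 («the canonical Kato's Euler system is integral under the large Galois
image assumption»).

SIZE to discharge: L–XL (Kato §13 — the construction of `𝐳_γ` on the modular curve, Thm. 12.4 (2), §13.14 —
plus the Betti/de Rham dictionary `(H₁(W(ℂ), ℤ), ω_W) ↔ (V_ℤ(f), S(f))` along the modular parametrisation; at
least three inputs are named facts only: `thm12_4`, `exists_eulerSystem_definedExpStar_values`,
`exists_isNewformOf`).  No `_holds` is attempted here.

## What is NOT here (scope)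

Not the length inequality of Thm. 12.5 (4) nor Thm. 12.5 (3) (tree: `EulerSystemBoundFineSelmerTwo.lean`,
`kato_divisibility`), not Conj. 12.10, not uniqueness of the admissible class across witnesses
(`AdmissibleZetaClassPositionProofs.lean`, audit), nothing at `p = 2` (the predicate is empty there by design,
`not_isAdmissibleZetaClass_two`) and nothing WITHOUT (12.5.2): C. Wuthrich, Doc. Math. 19 (2014) [Wuthrich2014]
proves integrality of Kato's classes beyond (12.5.2) — a different (stronger) statement, not transcribed.
-- TODO(general form): Kato's Thm. 12.5 (4) for newforms of weight `k ≥ 2` with coefficients (`F ≠ ℚ`), every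
-- stable lattice `T`, all `Δ`-components of `𝐇¹(T)` over `O_λ[[G_∞]]`, and its length inequality.

## Consumer (Summits side; nothing of it is asserted here)

Route item stmt-BirchSwinnertonDyer-23029 `AdmissibleZetaClassExists` reads `∀ W p, (5 ≤ p ∧ IsOrdinaryAt W p ∧
W.HasSurjectiveModNGaloisRep p) → ∃ K hK γ I z₀, K.IsTopGenerator γ ∧ IsAdmissibleZetaClass W p K hK I z₀`; granted
`(h : exists_isAdmissibleZetaClass_of_imageContainsSL2)` it is the corollary
`exists_datum_of_hasSurjectiveModNGaloisRep` below (`5 ≤ p` and `ρ̄_{E,p}` onto give (12.5.2) by Serre's lifting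
lemma, tree theorem `imageContainsSL2_of_hasSurjectiveModNGaloisRep`; the pin exists by the tree theorem
`nonempty_iwasawaH1Data_holds`; the normalised cyclotomic `ℤ_p`-extension is `CyclotomicZp.zpExtension`).

References: [Kato2004Asterisque] Thm. 12.5 (1)(2) (p. 221), Thm. 12.5 (4) with (12.5.2) (p. 222), 12.8 (p. 223),
§13.9–13.12 (pp. 229–232), Lemma 13.10 (1) (p. 230), Lemma 13.11 (2) (p. 231), §13.14 (p. 234), Ex. 13.3 (p. 225),
Thm. 12.4 (2)(3) (p. 221), p. 119, 17.5 (p. 274); [BreuilConradDiamondTaylor2001] Thm. A; [BlochKato1990] §3,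
Prop. 3.8, Ex. 3.11; [Manin1972] Thm. 1.6, Cor. 3.6; [MazurTateTeitelbaum1986Invent] §I.8; [Edixhoven1991] §1;
[RohrlichInventiones1984] Theorem p. 409; [SerreAbelianLadic1968] IV-23 Lemma 3; [Kim2024BeilinsonKatoZetaGuide]
§2.5.1, §4.3; [Kim2022RefinedKatoApplications] §1; [Wuthrich2014] (scope note only).  Tree:
`Kato2004/AdmissibleZetaClass.lean`, `Kato2004/Condition1252.lean`, `Kato2004/IwasawaCohomology.lean` +
`IwasawaCohomologyExistsProofs.lean`, `CyclotomicZpExtension.lean`.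
-/

namespace Literature.NumberTheory.EllipticCurves.Kato2004

open Field
open Literature.NumberTheory.EllipticCurves

/-! ## The named fact -/

/-- **Kato 2004, Thm. 12.5 (1) + (4) — REALISABILITY of an admissible zeta class (the integrality
`Z(f, T) ⊂ 𝐇¹(T)` for `T = T_pW(−1)`, `Δ`-trivial component, in the tree's vocabulary).**  For every globally
minimal elliptic curve `W/ℚ`, every prime `p ≠ 2` satisfying Kato's (12.5.2) for `T_pW` («there exists a
`ℤ_p`-basis of `T` for which the image of `Gal(ℚ̄/ℚ(ζ_{p^∞})) → GL₂(ℤ_p)` contains `SL₂(ℤ_p)`», the tree's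
`ImageContainsSL2 W p`), every cyclotomic `ℤ_p`-extension `κ` of `ℚ` with topological generator `γ`, and EVERY
pinned Iwasawa cohomology `I : IwasawaH1Data W p κ γ` (`I.H = 𝐇¹_Γ(T_pW) = lim←_n H¹(ℤ_n[1/p], T_pW)`), there is a
class `z₀ ∈ I.H` with `IsAdmissibleZetaClass W p κ hκ I z₀` — i.e. Kato's `Ω_W`-normalised zeta element `𝐳_{γ_W}`
(Thm. 12.5 (1): «there exists a unique `F_λ`-linear map `V_{F_λ}(f) → 𝐇¹(V_{F_λ}(f)); γ ↦ 𝐳_γ^{(p)}` having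
the following property …» [p. 221]) lies in `𝐇¹(T)` itself, not only in `𝐇¹(T) ⊗ ℚ` (Thm. 12.5 (4): «Assume
`p ≠ 2`, and assume that the following (12.5.2) is satisfied. … Then, `Z(f, T) ⊂ 𝐇¹(T)`» [p. 222]; proof §13.14
[p. 234]).  The existential witnesses bundled by the predicate and their printed sources (module docstring):
the newform of `W` (modularity, [BreuilConradDiamondTaylor2001, Thm. A], as Kato p. 119), Kato's value-pinned
`(c, d₁)`-family with the dual exponential DEFINED (tree fact `exists_eulerSystem_definedExpStar_values`), the
Manin lattice of minus symbols, the rational period ratio `Ω⁺_f/Ω_W`, and the position of `z₀` on the `Λ`-line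
of the family's lift (Thm. 12.5 (1) + Thm. 12.4 (2) + Lemma 13.10 (1)).  A SPECIAL CASE of print (elliptic
curves over `ℚ`, the lattice `T_pW`, the `Δ`-trivial component); the length inequality of (4) is NOT part of
this fact.  Named fact; nothing asserted; no `_holds` here (size L–XL).
[cite: Kato2004Asterisque, Thm. 12.5 (1) (p. 221) and Thm. 12.5 (4) with (12.5.2) (p. 222); §13.14 (p. 234); §13.9–13.12 (pp. 229–232); 12.8 (p. 223); p. 119]
[cite: Kim2024BeilinsonKatoZetaGuide, §2.5.1 (Thm. 2.18) and §4.3]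
[cite: BreuilConradDiamondTaylor2001, Thm. A] [cite: BlochKato1990, §3, Prop. 3.8 and Example 3.11]
[cite: Manin1972, Thm. 1.6 and Cor. 3.6] -/
def exists_isAdmissibleZetaClass_of_imageContainsSL2 : Prop :=
  ∀ (W : WeierstrassCurve ℚ) [W.IsElliptic] [W.IsGloballyMinimal] (p : ℕ) [Fact p.Prime]
    [ContinuousSMul ℤ_[p] (W.tateModule p)] (κ : ZpExtension ℚ p) (γ : absoluteGaloisGroup ℚ)
    (hκ : κ.IsCyclotomic), κ.IsTopGenerator γ → p ≠ 2 → ImageContainsSL2 W p →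
      ∀ I : IwasawaH1Data W p κ γ, ∃ z₀ : I.H, IsAdmissibleZetaClass W p κ hκ I z₀

-- TODO(general form): Kato's Thm. 12.5 (4) `Z(f, T) ⊂ 𝐇¹(T)` for every newform `f` of weight `k ≥ 2` and
-- level `N` with coefficient field `F`, every `Gal(ℚ̄/ℚ)`-stable `O_λ`-lattice `T ⊂ V_{F_λ}(f)` under (12.5.2),
-- on the full `Λ = O_λ[[G_∞]]` (all `Δ`-components), together with its height-one length inequality.

/-! ## Proved corollaries (re-shapings for the consumer; no new fact) -/

namespace exists_isAdmissibleZetaClass_of_imageContainsSL2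

/-- **`p`-adic surjectivity form.**  Under the fact: if `p ≠ 2` and `ρ̄_{E,p^n} : Γ_ℚ → Aut(E[p^n])` is onto for
every `n` (the surjectivity binder of the tree's Kato facts; it IS (12.5.2) by
`imageContainsSL2_of_forall_hasSurjectiveModNGaloisRep`), every pinned `𝐇¹_Γ(T_pW)` over a cyclotomic datum
carries an admissible zeta class. [cite: Kato2004Asterisque, Thm. 12.5 (4) with (12.5.2) (p. 222)] -/
theorem of_forall_hasSurjectiveModNGaloisRep (h : exists_isAdmissibleZetaClass_of_imageContainsSL2)
    (W : WeierstrassCurve ℚ) [W.IsElliptic] [W.IsGloballyMinimal] (p : ℕ) [Fact p.Prime]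
    [ContinuousSMul ℤ_[p] (W.tateModule p)] {κ : ZpExtension ℚ p} {γ : absoluteGaloisGroup ℚ}
    (hκ : κ.IsCyclotomic) (hγ : κ.IsTopGenerator γ) (hp : p ≠ 2)
    (hsurj : ∀ n : ℕ, W.HasSurjectiveModNGaloisRep (p ^ n : ℕ)) (I : IwasawaH1Data W p κ γ) :
    ∃ z₀ : I.H, IsAdmissibleZetaClass W p κ hκ I z₀ :=
  h W p κ γ hκ hγ hp (imageContainsSL2_of_forall_hasSurjectiveModNGaloisRep W p hsurj) I

/-- **Door-prime form (`p ≥ 5`, `ρ̄_{E,p}` onto).**  Under the fact: for `p ≥ 5` with `ρ̄_{E,p}` surjective —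
(12.5.2) by Serre's lifting lemma (`imageContainsSL2_of_hasSurjectiveModNGaloisRep`) — every pinned `𝐇¹_Γ(T_pW)`
over a cyclotomic datum carries an admissible zeta class.  (This is the hypothesis shape of the route's door
`5 ≤ p ∧ IsOrdinaryAt W p ∧ W.HasSurjectiveModNGaloisRep p`; ordinarity is not used.)
[cite: Kato2004Asterisque, Thm. 12.5 (4) with (12.5.2) (p. 222)] [cite: SerreAbelianLadic1968, Ch. IV §3.4 Lemma 3 (IV-23)] -/
theorem of_hasSurjectiveModNGaloisRep (h : exists_isAdmissibleZetaClass_of_imageContainsSL2)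
    (W : WeierstrassCurve ℚ) [W.IsElliptic] [W.IsGloballyMinimal] (p : ℕ) [Fact p.Prime]
    [ContinuousSMul ℤ_[p] (W.tateModule p)] {κ : ZpExtension ℚ p} {γ : absoluteGaloisGroup ℚ}
    (hκ : κ.IsCyclotomic) (hγ : κ.IsTopGenerator γ) (h5 : 5 ≤ p) (hsurj : W.HasSurjectiveModNGaloisRep p)
    (I : IwasawaH1Data W p κ γ) : ∃ z₀ : I.H, IsAdmissibleZetaClass W p κ hκ I z₀ :=
  h W p κ γ hκ hγ (by omega) (imageContainsSL2_of_hasSurjectiveModNGaloisRep W p h5 hsurj) I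

/-- **Existential-datum form.**  Under the fact: for `p ≠ 2` with (12.5.2) there EXIST a cyclotomic
`ℤ_p`-extension `K` of `ℚ` (the normalised one, `CyclotomicZp.zpExtension`), a topological generator `γ`
(`CyclotomicZp.exists_isTopGenerator_zpExtension`), a pinned Iwasawa cohomology `I` (tree theorem
`nonempty_iwasawaH1Data_holds`) and an admissible zeta class `z₀ ∈ I.H`.
[cite: Kato2004Asterisque, Thm. 12.5 (4) with (12.5.2) (p. 222); §12.2 (12.2.1) (p. 220)] -/
theorem exists_datum (h : exists_isAdmissibleZetaClass_of_imageContainsSL2)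
    (W : WeierstrassCurve ℚ) [W.IsElliptic] [W.IsGloballyMinimal] (p : ℕ) [Fact p.Prime]
    [ContinuousSMul ℤ_[p] (W.tateModule p)] (hp : p ≠ 2) (hSL : ImageContainsSL2 W p) :
    ∃ (K : ZpExtension ℚ p) (hK : K.IsCyclotomic) (γ : absoluteGaloisGroup ℚ) (I : IwasawaH1Data W p K γ)
      (z₀ : I.H), K.IsTopGenerator γ ∧ IsAdmissibleZetaClass W p K hK I z₀ := by
  obtain ⟨γ, hγ, -⟩ := CyclotomicZp.exists_isTopGenerator_zpExtension p
  obtain ⟨I⟩ := nonempty_iwasawaH1Data_holds W p (CyclotomicZp.zpExtension p) γ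
    (CyclotomicZp.isCyclotomic_zpExtension p) hγ
  obtain ⟨z₀, hz₀⟩ :=
    h W p (CyclotomicZp.zpExtension p) γ (CyclotomicZp.isCyclotomic_zpExtension p) hγ hp hSL I
  exact ⟨CyclotomicZp.zpExtension p, CyclotomicZp.isCyclotomic_zpExtension p, γ, I, z₀, hγ, hz₀⟩

/-- **Existential-datum form at a door prime** — verbatim the matrix of the route item
`AdmissibleZetaClassExists` (stmt-BirchSwinnertonDyer-23029) once its door hypothesis is split into `5 ≤ p` and
`ρ̄_{E,p}` onto (its ordinarity conjunct is not used): under the fact, such `(K, hK, γ, I, z₀)` exist.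
[cite: Kato2004Asterisque, Thm. 12.5 (4) with (12.5.2) (p. 222)] [cite: SerreAbelianLadic1968, Ch. IV §3.4 Lemma 3 (IV-23)] -/
theorem exists_datum_of_hasSurjectiveModNGaloisRep (h : exists_isAdmissibleZetaClass_of_imageContainsSL2)
    (W : WeierstrassCurve ℚ) [W.IsElliptic] [W.IsGloballyMinimal] (p : ℕ) [Fact p.Prime]
    [ContinuousSMul ℤ_[p] (W.tateModule p)] (h5 : 5 ≤ p) (hsurj : W.HasSurjectiveModNGaloisRep p) :
    ∃ (K : ZpExtension ℚ p) (hK : K.IsCyclotomic) (γ : absoluteGaloisGroup ℚ) (I : IwasawaH1Data W p K γ)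
      (z₀ : I.H), K.IsTopGenerator γ ∧ IsAdmissibleZetaClass W p K hK I z₀ :=
  h.exists_datum W p (by omega) (imageContainsSL2_of_hasSurjectiveModNGaloisRep W p h5 hsurj)

end exists_isAdmissibleZetaClass_of_imageContainsSL2

end Literature.NumberTheory.EllipticCurves.Kato2004
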